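import Summits.Ventures.PercRepro.S2FourteenSevenNuFour
import Summits.Ventures.PercRepro.S2TopSixSeven
import Summits.Ventures.PercRepro.S2NullityLever
import Summits.Ventures.PercRepro.S2CircuitNullity
import Summits.Ventures.PercRepro.S2TopSixThrough
import Summits.Ventures.PercRepro.S2SpreadSevenTools
import Summits.Ventures.PercRepro.S2FourteenSevenSpreadNine
import Summits.Ventures.PercRepro.S2IndepFiveCount
import Summits.Ventures.PercRepro.S2SpreadTail
import Summits.Ventures.PercRepro.S2BasesTriangles

/-!
# PercRepro — S2: THE SPREAD CASE OF THE CELL `(14, 7)` COLOOP-FREE AT `7` TRIANGLES (p7, gen 14; sub-claim S2)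

The row `t = 7`: **`c025_fourteen_seven_cf_spread_seven`**. Per triangle `T` the charge is `≤ 616`: (a) three avoiding
triangles — `≤ 408`; (b) two — `≤ 530`; (c) one — `≤ 550` (as in the row `t = 8`); (d) none — every point of `T` carries two
further triangles (`S2.forall_exists_four_circuit_of_seven_le`), with pairwise distinct quadruples `Q_x, Q_y, Q_z`; if
`Q_z ⊄ Q_x ∪ Q_y` the union has nullity `≥ 3` on `≤ 12` points (`≤ 616`); otherwise `Q_x ∪ Q_y` has `8` points (with `≤ 7`
the triangle would lie in its closure) so `Q_x, Q_y` are disjoint, `Q_y ⊄ Q_x ∪ Q_z`, and `Q_x ∪ Q_z ∪ Q_y = Q_x ∪ Q_y` has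
nullity `≥ 3` on `8` points (`≤ 336`). The row: `(U, S, m) = (44168, 137288, 101)`, ratio `0.987`. Axioms: standard.
-/

open scoped Matroid

namespace PercRepro

namespace ThmN

open Set

variable {α : Type}

/-- **The spread case of the coloop-free cell `(14, 7)` at `7` triangles.** -/
theorem c025_fourteen_seven_cf_spread_seven (M : Matroid α) [M.Finite]
    (hR : M.eRank = ((14 : ℕ) : ℕ∞)) (hn : M.E.ncard = 14 + 7)
    (hfree : ∀ e ∈ M.E, ∃ A ⊆ M.E \ {e}, e ∉ M.closure A ∧ e ∉ M.closure ((M.E \ {e}) \ A)) (hK : ∀ e, ¬ M.IsColoop e)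
    (h4 : ¬ ∃ W ⊆ M.E, W.ncard ≤ 9 ∧ W.encard = M.eRk W + 4)
    (ht7 : {C : Set α | M.IsCircuit C ∧ C.ncard = 3}.ncard = 7) : RLS M 14 5 := by
  classical
  have hd : M.E.encard = M.eRank + ((7 : ℕ) : ℕ∞) := by
    rw [hR, ← M.ground_finite.cast_ncard_eq, hn]
    push_cast
    ring
  obtain ⟨-, hs4, hs5⟩ := caps_fourteen_seven_cf M hd hn hfree hK
  have hflat : ∀ X ⊆ M.E, M.eRk X ≤ 5 → X.ncard ≤ 8 := fun X hX hr => by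
    have := S2.ncard_le_of_eRk_le_of_not_nullity M 4 9 (by norm_num) h4 hX (r := 5) (by norm_num) (by exact_mod_cast hr)
    omega
  have hflat' : ∀ X ⊆ M.E, M.eRk X ≤ 4 → X.ncard ≤ 7 := fun X hX hr => by
    have := S2.ncard_le_of_eRk_le_of_not_nullity M 4 9 (by norm_num) h4 hX (r := 4) (by norm_num) (by exact_mod_cast hr)
    omega
  have hEcard : M.ground_finite.toFinset.card = 14 + 7 := by
    rw [← Set.ncard_eq_toFinset_card _ M.ground_finite]; exact hn
  have hL0 : ∀ e ∈ M.E, ¬ M.IsLoop e := not_isLoop_of_free M hfree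
  have hs : ∀ e ∈ M.E, ∀ f ∈ M.E, e ≠ f → M.eRk {e, f} = 2 := by
    intro e he f hf hef
    have h2 : (2 : ℕ∞) ≤ M.eRk {e, f} :=
      two_le_eRk_of_two_le_ncard_of_free M hfree (pair_subset he hf) (by rw [ncard_pair hef])
    have h3 : M.eRk {e, f} ≤ 2 := by
      have := M.eRk_le_encard {e, f}
      rwa [encard_pair hef] at this
    exact le_antisymm h3 h2
  have hC1 : ∀ L ⊆ M.E, M.eRk L = 2 → L.ncard ≤ 3 :=
    fun L hL hr => ncard_le_three_of_eRk_two M hs hfree hL hr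
  have hcirc : ∀ C, M.IsCircuit C → 3 ≤ C.encard := three_le_encard_of_circuit M hL0 hs
  have hTfin : {C : Set α | M.IsCircuit C ∧ C.ncard = 3}.Finite :=
    M.ground_finite.finite_subsets.subset (fun C hC => hC.1.subset_ground)
  have h9 : ∀ X ⊆ M.E, X.ncard ≤ 9 → X.encard ≤ M.eRk X + 3 := by
    intro X hX hX9
    by_contra hlt
    push Not at hlt
    have hk : M.eRk X + 4 ≤ X.encard := by
      have := Order.add_one_le_of_lt hlt
      rwa [add_assoc, show (3 : ℕ∞) + 1 = 4 by norm_num] at this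
    obtain ⟨W', hW'X, hW'⟩ := S2.exists_subset_encard_eq_eRk_add M hX 4 hk
    exact h4 ⟨W', hW'X.trans hX, (Set.ncard_le_ncard hW'X (M.ground_finite.subset hX)).trans hX9, hW'⟩
  have hs6 : {C : Set α | M.IsCircuit C ∧ C.ncard = 6}.ncard ≤ (7 + 5).choose 6 :=
    Matroid.ncard_circuits_le_choose_of_encard M hd 5
  norm_num [Nat.choose] at hs6
  have cellA : ∀ (U S m : ℕ) (A : ℚ), Matroid.topCount M 14 5 ≤ U → {X : Set α | X ⊆ M.E ∧ M.eRk X = M.eRank}.ncard ≤ S → m ≤ 1024 →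
      1024 * (U : ℚ) ≤ ((1024 - m : ℕ) : ℚ) * 2 ^ (7 - 5) * (12417 : ℚ) →
      (1024 : ℚ) * (A + (S : ℚ)) ≤ (m : ℚ) * 2 ^ 21 →
      ({X : Set α | X ⊆ M.E ∧ M.eRk X ≤ 5}.ncard : ℚ) ≤ A → RLS M 14 5 := by
    intro U S m A hU hS hm hpoly htail hA
    rw [RLS_iff]
    exact c025_core_five_cell_of_counts_xqictq5g M 14 7 (by norm_num) hR hn U hU _ hA S hS
      12417 (by norm_num) (phiK 14 5) (by rw [S2.phiK_fourteen_five]; norm_num) ⟨m, hm, hpoly, htail⟩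
  -- the top count through the top `5`- and `6`-sets
  have hUsum := S2.topCount_mul_five_le_seven M hR hd hC1 hflat
  -- the top `5`-sets are independent `5`-sets
  have htop5 : {B : Set α | B ⊆ M.E ∧ B.ncard = 5 ∧ M.eRk B = 5 ∧ M.eRk (M.E \ B) = M.eRank}.ncard ≤
      {B : Set α | B ⊆ M.E ∧ B.ncard = 5 ∧ M.eRk B = 5}.ncard :=
    Set.ncard_le_ncard (fun B hB => ⟨hB.1, hB.2.1, hB.2.2.1⟩)
      (M.ground_finite.finite_subsets.subset (fun B hB => hB.1))
  have hind5 := S2.ncard_indep_five_add_le (M := M) hC1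
  rw [hn] at hind5
  norm_num [Nat.choose] at hind5
  -- the top `6`-sets through circuits, with a per-triangle charge `c`
  have htop6_le : ∀ (c : ℕ), (∀ T : Set α, M.IsCircuit T → T.ncard = 3 →
      {B : Set α | B ⊆ M.E ∧ B.ncard = 6 ∧ T ⊆ B ∧ M.eRk (M.E \ B) = M.eRank}.ncard ≤ c) →
      {B : Set α | B ⊆ M.E ∧ B.ncard = 6 ∧ M.eRk B = 5 ∧ M.eRk (M.E \ B) = M.eRank}.ncard ≤
        {C : Set α | M.IsCircuit C ∧ C.ncard = 3}.ncard * c + 56 * 136 + 307 * 16 + 924 := by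
    intro c hc
    have := S2.ncard_top_six_le_n M hn hcirc c hc
    norm_num [Nat.choose] at this
    have h4' := Nat.mul_le_mul_right 136 hs4
    have h5' := Nat.mul_le_mul_right 16 hs5
    omega
  -- the per-triangle charge at `t = 7`: `≤ 616` in every configuration of the avoiding circuits
  have hc616 : ∀ T : Set α, M.IsCircuit T → T.ncard = 3 →
      {B : Set α | B ⊆ M.E ∧ B.ncard = 6 ∧ T ⊆ B ∧ M.eRk (M.E \ B) = M.eRank}.ncard ≤ 616 := by
    intro T hT hT3
    have hTfin' : T.Finite := M.ground_finite.subset hT.subset_ground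
    have h7 := S2.ncard_triangles_le_seven_add_disjoint M hC1 h9 hT hT3
    have h𝒟fin : {C : Set α | M.IsCircuit C ∧ C.ncard = 3 ∧ Disjoint C T}.Finite :=
      hTfin.subset (fun C hC => ⟨hC.1, hC.2.1⟩)
    have hZ : (M.E \ T).ncard = 18 := by
      rw [Set.ncard_sdiff hT.subset_ground hTfin', hn, hT3]
    -- the lever on an avoiding set of nullity `≥ 3` and `≤ u` points
    have lever : ∀ (P : Set α) (u : ℕ), P ⊆ M.E \ T → M.eRk P + 3 ≤ P.encard → P.ncard ≤ u → u ≤ 12 →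
        {B : Set α | B ⊆ M.E ∧ B.ncard = 6 ∧ T ⊆ B ∧ M.eRk (M.E \ B) = M.eRank}.ncard ≤
          u.choose 2 * (18 - u) + u.choose 3 := by
      intro P u hP hP3 hPu hu12
      have h := S2.ncard_top_six_through_le_of_nullity_three M hR hn hT.subset_ground hT3 hP hP3
      rw [hZ] at h
      refine h.trans ?_
      generalize P.ncard = v at hPu
      interval_cases u <;> interval_cases v <;> norm_num [Nat.choose]
    have hTcl : ∀ (P : Set α) {u v : α}, u ∈ T → v ∈ T → u ≠ v → u ∈ M.closure P → v ∈ M.closure P →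
        T ⊆ M.closure P := fun P _ _ hu hv huv huP hvP =>
      S2.triangle_subset_closure_of_two_mem M hT hT3 hu hv huv huP hvP
    -- (a) three avoiding triangles: `≤ 408`
    have case_a : 3 ≤ {C : Set α | M.IsCircuit C ∧ C.ncard = 3 ∧ Disjoint C T}.ncard →
        {B : Set α | B ⊆ M.E ∧ B.ncard = 6 ∧ T ⊆ B ∧ M.eRk (M.E \ B) = M.eRank}.ncard ≤ 408 := by
      intro h3
      obtain ⟨D₁, D₂, D₃, hD₁, hD₂, hD₃, h12, h13, h23⟩ := (Set.two_lt_ncard_iff h𝒟fin).1 (by omega)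
      have hP3 := S2.eRk_union_three_triangles_add_three_le M hC1 hD₁.1 hD₁.2.1 hD₂.1 hD₂.2.1 hD₃.1 hD₃.2.1 h12 h13 h23
      have hP : D₁ ∪ D₂ ∪ D₃ ⊆ M.E \ T := by
        refine Set.union_subset (Set.union_subset ?_ ?_) ?_
        · exact Set.subset_sdiff.2 ⟨hD₁.1.subset_ground, hD₁.2.2⟩
        · exact Set.subset_sdiff.2 ⟨hD₂.1.subset_ground, hD₂.2.2⟩
        · exact Set.subset_sdiff.2 ⟨hD₃.1.subset_ground, hD₃.2.2⟩
      have hu : (D₁ ∪ D₂ ∪ D₃).ncard ≤ 9 := by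
        have h1 := Set.ncard_union_le (D₁ ∪ D₂) D₃
        have h2 := Set.ncard_union_le D₁ D₂
        have h3 := hD₁.2.1
        have h4 := hD₂.2.1
        have h5 := hD₃.2.1
        omega
      exact (lever _ 9 hP hP3 hu (by norm_num)).trans (by norm_num [Nat.choose])
    -- (b) two avoiding triangles and a `4`-circuit avoiding `T`: `≤ 530`
    have case_b : 2 ≤ {C : Set α | M.IsCircuit C ∧ C.ncard = 3 ∧ Disjoint C T}.ncard →
        (∃ Q : Set α, M.IsCircuit Q ∧ Q.ncard = 4 ∧ Disjoint Q T) →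
        {B : Set α | B ⊆ M.E ∧ B.ncard = 6 ∧ T ⊆ B ∧ M.eRk (M.E \ B) = M.eRank}.ncard ≤ 530 := by
      intro h2 hQex
      obtain ⟨D₁, D₂, hD₁, hD₂, h12⟩ := (Set.one_lt_ncard_iff h𝒟fin).1 (by omega)
      obtain ⟨Q, hQ, hQ4, hQT⟩ := hQex
      have hD₁E : D₁ ⊆ M.E \ T := Set.subset_sdiff.2 ⟨hD₁.1.subset_ground, hD₁.2.2⟩
      have hD₂E : D₂ ⊆ M.E \ T := Set.subset_sdiff.2 ⟨hD₂.1.subset_ground, hD₂.2.2⟩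
      have hQE : Q ⊆ M.E \ T := Set.subset_sdiff.2 ⟨hQ.subset_ground, hQT⟩
      have hD₁fin : D₁.Finite := M.ground_finite.subset hD₁.1.subset_ground
      have hD₂fin : D₂.Finite := M.ground_finite.subset hD₂.1.subset_ground
      have hU6 : (D₁ ∪ D₂).ncard ≤ 6 := by
        have := Set.ncard_union_le D₁ D₂
        have h3 := hD₁.2.1
        have h4 := hD₂.2.1
        omega
      by_cases hU5 : (D₁ ∪ D₂).ncard ≤ 5
      · -- the two triangles share a point: the plain hitting lever
        have h := S2.ncard_top_six_through_add_le M hR hn hT.subset_ground hT3 hD₁.1 hD₂.1 h12 hD₁.2.2 hD₂.2.2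
        have hk : 13 ≤ ((M.E \ T) \ (D₁ ∪ D₂)).ncard := by
          rw [Set.ncard_sdiff (Set.union_subset hD₁E hD₂E) (hD₁fin.union hD₂fin), hZ]
          omega
        have hch : (13 : ℕ).choose 3 ≤ ((M.E \ T) \ (D₁ ∪ D₂)).ncard.choose 3 := Nat.choose_le_choose 3 hk
        rw [hZ] at h
        norm_num [Nat.choose] at h hch
        omega
      push Not at hU5
      have hU6' : (D₁ ∪ D₂).ncard = 6 := by omega
      by_cases hQsub : Q ⊆ D₁ ∪ D₂
      · -- `Q` inside the two disjoint triangles: `D₁ ∪ D₂ ⊆ cl Q`, rank `3`, nullity `3`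
        have hdisj : Disjoint D₁ D₂ := by
          rw [Set.disjoint_iff_inter_eq_empty, ← Set.ncard_eq_zero (hD₁fin.subset Set.inter_subset_left)]
          have := Set.ncard_union_add_ncard_inter D₁ D₂ hD₁fin hD₂fin
          have h3 := hD₁.2.1
          have h4 := hD₂.2.1
          omega
        have hQfin : Q.Finite := M.ground_finite.subset hQ.subset_ground
        have hsplit : (Q ∩ D₁).ncard + (Q ∩ D₂).ncard = 4 := by
          rw [← hQ4, ← Set.ncard_union_eq (hdisj.mono Set.inter_subset_right Set.inter_subset_right)
            (hQfin.subset Set.inter_subset_left) (hQfin.subset Set.inter_subset_left), ← Set.inter_union_distrib_left,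
            Set.inter_eq_left.2 hQsub]
        have hnot : ∀ {D : Set α}, M.IsCircuit D → D.ncard = 3 → (Q ∩ D).ncard ≤ 2 := by
          intro D hD hD3
          by_contra hlt
          push Not at hlt
          have hDfin : D.Finite := M.ground_finite.subset hD.subset_ground
          have hle : D.ncard ≤ (Q ∩ D).ncard := by omega
          have heq : Q ∩ D = D := Set.eq_of_subset_of_ncard_le Set.inter_subset_right hle hDfin
          have hDQ : D ⊆ Q := by rw [← heq]; exact Set.inter_subset_left
          have := hD.eq_of_subset_isCircuit hQ hDQ
          rw [this, hQ4] at hD3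
          omega
        have hcl : ∀ {D : Set α}, M.IsCircuit D → D.ncard = 3 → (Q ∩ D).ncard = 2 → D ⊆ M.closure Q := by
          intro D hD hD3 h2
          obtain ⟨a, b, hab, hQD⟩ := Set.ncard_eq_two.1 h2
          have haQ : a ∈ Q ∩ D := by rw [hQD]; exact Set.mem_insert a {b}
          have hbQ : b ∈ Q ∩ D := by rw [hQD]; exact Set.mem_insert_of_mem a (Set.mem_singleton b)
          have hsub := S2.subset_closure_pair_of_dep_three M hs hD.subset_ground hD3 hD.dep haQ.2 hbQ.2 hab
          refine hsub.trans (M.closure_subset_closure ?_)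
          exact Set.insert_subset haQ.1 (Set.singleton_subset_iff.2 hbQ.1)
        have h1 := hnot hD₁.1 hD₁.2.1
        have h2 := hnot hD₂.1 hD₂.2.1
        have hP3 : M.eRk (D₁ ∪ D₂) + 3 ≤ (D₁ ∪ D₂).encard := by
          have hsubcl : D₁ ∪ D₂ ⊆ M.closure Q :=
            Set.union_subset (hcl hD₁.1 hD₁.2.1 (by omega)) (hcl hD₂.1 hD₂.2.1 (by omega))
          have hrk : M.eRk (D₁ ∪ D₂) ≤ 3 := by
            have hQr := hQ.eRk_add_one_eq
            rw [← hQfin.cast_ncard_eq, hQ4] at hQr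
            have hQr' : M.eRk Q ≤ 3 := by
              have : M.eRk Q + 1 ≤ 3 + 1 := by rw [hQr]; norm_num
              exact (ENat.add_le_add_iff_right (by simp)).1 this
            calc M.eRk (D₁ ∪ D₂) ≤ M.eRk (M.closure Q) := M.eRk_mono hsubcl
              _ = M.eRk Q := M.eRk_closure_eq Q
              _ ≤ 3 := hQr'
          rw [← (hD₁fin.union hD₂fin).cast_ncard_eq, hU6']
          calc M.eRk (D₁ ∪ D₂) + 3 ≤ 3 + 3 := by gcongr
            _ = ((6 : ℕ) : ℕ∞) := by norm_num
        exact (lever _ 6 (Set.union_subset hD₁E hD₂E) hP3 hU6'.le (by norm_num)).trans (by norm_num [Nat.choose])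
      · -- `Q` not inside `D₁ ∪ D₂`: the three circuits have a union of nullity `≥ 3` on `≤ 10` points
        have hP3 := S2.eRk_union_three_add_three_le_encard M hD₁.1 hD₂.1 hQ h12 hQsub
        have hu : (D₁ ∪ D₂ ∪ Q).ncard ≤ 10 := by
          have := Set.ncard_union_le (D₁ ∪ D₂) Q
          omega
        exact (lever _ 10 (Set.union_subset (Set.union_subset hD₁E hD₂E) hQE) hP3 hu (by norm_num)).trans
          (by norm_num [Nat.choose])
    -- (c) one avoiding triangle `D` and two quadruples `Q_u`, `Q_v`: `≤ 550`, or `T ⊆ cl (D ∪ Q_u)` with `≤ 7` points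
    have case_c : ∀ D : Set α, M.IsCircuit D → D.ncard = 3 → Disjoint D T →
        (∃ u ∈ T, ∃ v ∈ T, u ≠ v ∧ ∃ Qu Qv : Set α, M.IsCircuit Qu ∧ Qu.ncard = 4 ∧ Disjoint Qu T ∧ u ∈ M.closure Qu ∧
          M.IsCircuit Qv ∧ Qv.ncard = 4 ∧ Disjoint Qv T ∧ v ∈ M.closure Qv) →
        {B : Set α | B ⊆ M.E ∧ B.ncard = 6 ∧ T ⊆ B ∧ M.eRk (M.E \ B) = M.eRank}.ncard ≤ 550 := by
      rintro D hD hD3 hDT ⟨u, hu, v, hv, huv, Qu, Qv, hQu, hQu4, hQuT, huQ, hQv, hQv4, hQvT, hvQ⟩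
      have hDE : D ⊆ M.E \ T := Set.subset_sdiff.2 ⟨hD.subset_ground, hDT⟩
      have hQuE : Qu ⊆ M.E \ T := Set.subset_sdiff.2 ⟨hQu.subset_ground, hQuT⟩
      have hQvE : Qv ⊆ M.E \ T := Set.subset_sdiff.2 ⟨hQv.subset_ground, hQvT⟩
      have hDQ : D ≠ Qu := fun h => by rw [h, hQu4] at hD3; omega
      by_cases hsub : Qv ⊆ D ∪ Qu
      · exfalso
        have hP2 := S2.eRk_union_two_add_two_le_encard M hD hQu hDQ
        have hP7 : (D ∪ Qu).ncard ≤ 7 := by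
          have := Set.ncard_union_le D Qu
          omega
        have hTP : T ⊆ M.closure (D ∪ Qu) :=
          hTcl (D ∪ Qu) hu hv huv (M.closure_mono Set.subset_union_right huQ)
            (M.closure_mono hsub hvQ)
        exact S2.not_subset_closure_of_ncard_le_seven M h9 hT hT3 (Set.union_subset hD.subset_ground hQu.subset_ground)
          (Set.disjoint_union_left.2 ⟨hDT, hQuT⟩) hP7 hP2 hTP
      · have hP3 := S2.eRk_union_three_add_three_le_encard M hD hQu hQv hDQ hsub
        have hu11 : (D ∪ Qu ∪ Qv).ncard ≤ 11 := by
          have h1 := Set.ncard_union_le (D ∪ Qu) Qv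
          have h2 := Set.ncard_union_le D Qu
          omega
        exact (lever _ 11 (Set.union_subset (Set.union_subset hDE hQuE) hQvE) hP3 hu11 (by norm_num)).trans
          (by norm_num [Nat.choose])
    by_cases h3 : 3 ≤ {C : Set α | M.IsCircuit C ∧ C.ncard = 3 ∧ Disjoint C T}.ncard
    · exact (case_a h3).trans (by norm_num)
    push Not at h3
    by_cases h2 : 2 ≤ {C : Set α | M.IsCircuit C ∧ C.ncard = 3 ∧ Disjoint C T}.ncard
    · exact (case_b h2 (S2.exists_four_circuit_disjoint_of_six_le M hC1 hs h9 hT hT3 (by omega))).trans (by norm_num)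
    push Not at h2
    by_cases h1 : 1 ≤ {C : Set α | M.IsCircuit C ∧ C.ncard = 3 ∧ Disjoint C T}.ncard
    · obtain ⟨D, hD⟩ := (Set.ncard_pos h𝒟fin).1 h1
      exact (case_c D hD.1 hD.2.1 hD.2.2
        (S2.exists_two_points_four_circuits_of_six_le M hC1 hs h9 hT hT3 (by omega))).trans (by norm_num)
    push Not at h1
    -- (d) no avoiding triangle: the three quadruples `Q_x, Q_y, Q_z`
    have hall := S2.forall_exists_four_circuit_of_seven_le M hC1 hs h9 hT hT3 (by omega)
    obtain ⟨x, y, z, hxy, hxz, hyz, hTxyz⟩ := Set.ncard_eq_three.1 hT3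
    have hxT : x ∈ T := by rw [hTxyz]; exact Set.mem_insert x _
    have hyT : y ∈ T := by rw [hTxyz]; exact Set.mem_insert_of_mem x (Set.mem_insert y _)
    have hzT : z ∈ T := by
      rw [hTxyz]; exact Set.mem_insert_of_mem x (Set.mem_insert_of_mem y (Set.mem_singleton z))
    obtain ⟨Qx, hQx, hQx4, hQxT, hxQ⟩ := hall x hxT
    obtain ⟨Qy, hQy, hQy4, hQyT, hyQ⟩ := hall y hyT
    obtain ⟨Qz, hQz, hQz4, hQzT, hzQ⟩ := hall z hzT
    have hxyQ : Qx ≠ Qy := S2.four_circuits_ne_of_closure_mem M h9 hT hT3 hxT hyT hxy hQx hQx4 hQxT hxQ hQy hyQ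
    have hyzQ : Qy ≠ Qz := S2.four_circuits_ne_of_closure_mem M h9 hT hT3 hyT hzT hyz hQy hQy4 hQyT hyQ hQz hzQ
    have hQxE : Qx ⊆ M.E \ T := Set.subset_sdiff.2 ⟨hQx.subset_ground, hQxT⟩
    have hQyE : Qy ⊆ M.E \ T := Set.subset_sdiff.2 ⟨hQy.subset_ground, hQyT⟩
    have hQzE : Qz ⊆ M.E \ T := Set.subset_sdiff.2 ⟨hQz.subset_ground, hQzT⟩
    have hQxfin : Qx.Finite := M.ground_finite.subset hQx.subset_ground
    have hQyfin : Qy.Finite := M.ground_finite.subset hQy.subset_ground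
    by_cases hzsub : Qz ⊆ Qx ∪ Qy
    · have hP8 : (Qx ∪ Qy).ncard ≤ 8 := by
        have := Set.ncard_union_le Qx Qy
        omega
      by_cases hP7 : (Qx ∪ Qy).ncard ≤ 7
      · exfalso
        have hP2 := S2.eRk_union_two_add_two_le_encard M hQx hQy hxyQ
        have hTP : T ⊆ M.closure (Qx ∪ Qy) :=
          hTcl (Qx ∪ Qy) hxT hyT hxy (M.closure_mono Set.subset_union_left hxQ)
            (M.closure_mono Set.subset_union_right hyQ)
        exact S2.not_subset_closure_of_ncard_le_seven M h9 hT hT3 (Set.union_subset hQx.subset_ground hQy.subset_ground)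
          (Set.disjoint_union_left.2 ⟨hQxT, hQyT⟩) hP7 hP2 hTP
      · -- `Qx`, `Qy` disjoint: `Qy ⊄ Qx ∪ Qz`, else `Qy ⊆ Qz`
        have hdisj : Disjoint Qx Qy := by
          rw [Set.disjoint_iff_inter_eq_empty, ← Set.ncard_eq_zero (hQxfin.subset Set.inter_subset_left)]
          have := Set.ncard_union_add_ncard_inter Qx Qy hQxfin hQyfin
          omega
        have hysub : ¬ Qy ⊆ Qx ∪ Qz := by
          intro h
          have hyz' : Qy ⊆ Qz := by
            intro w hw
            rcases h hw with hwx | hwz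
            · exact absurd hwx (Set.disjoint_right.1 hdisj hw)
            · exact hwz
          exact hyzQ (hQy.eq_of_subset_isCircuit hQz hyz')
        have hxzQ : Qx ≠ Qz := S2.four_circuits_ne_of_closure_mem M h9 hT hT3 hxT hzT hxz hQx hQx4 hQxT hxQ hQz hzQ
        have hP3 := S2.eRk_union_three_add_three_le_encard M hQx hQz hQy hxzQ hysub
        have hu : (Qx ∪ Qz ∪ Qy).ncard ≤ 8 := by
          have heq : Qx ∪ Qz ∪ Qy = Qx ∪ Qy := by
            rw [Set.union_right_comm, Set.union_eq_left.2 hzsub]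
          rw [heq]
          exact hP8
        exact (lever _ 8 (Set.union_subset (Set.union_subset hQxE hQzE) hQyE) hP3 hu (by norm_num)).trans
          (by norm_num [Nat.choose])
    · have hP3 := S2.eRk_union_three_add_three_le_encard M hQx hQy hQz hxyQ hzsub
      have hu : (Qx ∪ Qy ∪ Qz).ncard ≤ 12 := by
        have h1 := Set.ncard_union_le (Qx ∪ Qy) Qz
        have h2 := Set.ncard_union_le Qx Qy
        omega
      exact lever _ 12 (Set.union_subset (Set.union_subset hQxE hQyE) hQzE) hP3 hu le_rfl
  -- the spanning counts
  have hSkit : {X : Set α | X ⊆ M.E ∧ M.eRk X = M.eRank}.ncard ≤ 198440 := by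
    have hS := Matroid.ncard_spanning_le (M := M) hd
    rw [hEcard] at hS
    exact hS.trans (by decide)
  have hspan3 : 3 ≤ {C : Set α | M.IsCircuit C ∧ C.ncard = 3}.ncard → {X : Set α | X ⊆ M.E ∧ M.eRk X = M.eRank}.ncard ≤ 137288 := by
    intro h3
    obtain ⟨T₁, T₂, T₃, hT₁, hT₂, hT₃, h12, h13, h23⟩ := (Set.two_lt_ncard_iff hTfin).1 (by omega)
    have hS := S2.ncard_spanning_add_le_of_three_triangles M hR hn (by norm_num) hC1 hT₁.1 hT₁.2 hT₂.1 hT₂.2 hT₃.1 hT₃.2 h12 h13 h23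
    norm_num [Finset.sum_range_succ, Nat.choose] at hS
    omega
  -- the exact triangle count `t` and the rank part of the tail at `t`
  obtain ⟨t, ht⟩ : ∃ t, {C : Set α | M.IsCircuit C ∧ C.ncard = 3}.ncard = t := ⟨_, rfl⟩
  have hA := ncard_eRk_le_five_le_spread M 14 7 (by norm_num) hR hn hfree hflat hflat' t 56 307 ht.le hs4 hs5
  rw [ht] at ht7 hspan3 htop6_le hind5
  have hS' := hspan3 (by omega)
  have h616 := htop6_le 616 hc616
  subst ht7
  norm_num [Nat.choose] at hind5 h616
  have hU' : Matroid.topCount M 14 5 ≤ 44168 := by omega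
  exact cellA _ 137288 101 _ hU' hS' (by norm_num) (by norm_num) (by norm_num [Nat.choose]) hA

end ThmN

end PercRepro
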